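import Summits.KontsevichZagierPeriods.KontsevichZagierPeriods.Theorems.KzOnePeriodsG2SOvalHomotopy

/-!
# G2S derivations, part 7: the ovals of `E_{A,B}`, their lifts through `φ_s`, and kz1p's factor symbols

Sub-problem `KzOnePeriods` (Huber–Wüstholz [cite: HuberWustholz2022, Thm 13.3 (2) (p. 121)]).  kz1p's
G2S certificates are written on the FACTOR symbols `W_j(E′_k) = ∫_{ε_j} dX/2Y` of the elliptic curves
`E′_k : Y² = X³ + AX + B` through which `J(C)` splits, `ε_j` the cycle over a 2-torsion interval
(`W₁` real over `[e₁, e₂]`, `W₂` purely imaginary over `[e₂, e₃]`), and reduce each `C`-period to them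
("pullback + orientation lemma": `∫_{c₁₂} x dx/2y = ½ W₁(E′₁)` on `C₆`).  This part makes those symbols
tree symbols and that reduction a theorem, for the polynomial quotient `φ_s = (x² + s, y)` of part 4:

* `exists_weierOval` — **the oval of `E_{A,B}` over a 2-torsion interval as a `C¹` loop**: for
  `X³ + AX + B = (X − p)(X − q)(X − r)` (real roots, `p` the base point, `q` the other end, the cofactor
  `−σ(X − r) > 0` between them, `σ = ±1`), the loop `X = (p+q)/2 + (p−q)/2 · cos 2πt`,
  `Y = ε (p−q)/2 · sin 2πt · √(−σ(X − r))`, `δ = (X, η·Y)` with `η² = σ` (`η = 1`: the real oval,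
  `σ = 1`; `η = i`: the imaginary oval, `σ = −1`), based at `(p, 0)`, through `(q, 0)` at `t = ½`,
  with `σY² = X³ + AX + B`.
* `exists_liftPath` — **the lift through `φ_s`**: a path `δ = (X, Y)` on `E_{A,B}` with real `X > s` on
  `[0, 1]` lifts to `γ = (√(X − s), Y)` on `C_{a,b,c}` (`f(x) = F(x² + s)`, `Split`) with `φ_s ∘ γ = δ`
  on `[0, 1]` exactly.
* `relation_factorOval` — **`∫_δ dX/Y = 4 · ∫_γ x dx/2y`** for EVERY oval loop `δ = (X, ηY)` of
  `E_{A,B}` over `[lo, hi] ∋ X` (`σF ≥ 0` there, `F(X(½)) = 0`) and EVERY oval loop `γ = (x, ηy)` of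
  `C_{a,b,c}` over `[√(lo − s), √(hi − s)]` on the same sheets with `x = √(X − s)` at `t = 0, ½, 1`:
  part 4's `relation_phi` for the lift of `δ`, then part 6 (`period_eq_of_ovalLoops`) to pass from the
  lift to `γ` — kz1p's reduction vector `∫_{c₁₂⁺} x dx/2y = ½·W₁`, `∫_{c₂₃⁺} x dx/2y = ½·W₂` as a theorem
  on explicit symbols (with `W = ∫_δ dX/2Y`).
Part 8 (`KzOnePeriodsG2SCMOvals`) adds the factor relations of the `j = 1728` factor on these ovals.

No definitions, no new axioms, no statement of the programme cited.
-/

noncomputable section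

open MvPolynomial Set Complex Filter Topology
open Literature.NumberTheory.Transcendental Literature.NumberTheory.Transcendental.CurvePeriods
open Summit.KontsevichZagierPeriods.KzOnePeriods.E1Derivation

namespace Summit.KontsevichZagierPeriods.KzOnePeriods.G2SDerivation

/-- The period `∫_γ ω` of the symbol `(Z, ω, γ)`. -/
local notation3 (prettyPrint := false) "Pe[" Z ", " hZ ", " ω ", " h ", " γ "]" =>
  PeriodSymbol.period (⟨Z, hZ, ω, h, γ⟩ : PeriodSymbol)

/-- The even sextic `f = x⁶ + a x⁴ + b x² + c ∈ ℂ[x, y]`. -/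
local notation3 (prettyPrint := false) "fS[" a ", " b ", " c "]" =>
  ((X 0 : MvPolynomial (Fin 2) ℂ) ^ 6 + C a * X 0 ^ 4 + C b * X 0 ^ 2 + C c)

/-- The affine plane model `C_{a,b,c} = {y² = f(x)} ⊂ 𝔸²`. -/
local notation3 (prettyPrint := false) "Cpl[" a ", " b ", " c "]" =>
  (⟨2, 1, ![(X 1 : MvPolynomial (Fin 2) ℂ) ^ 2 - fS[a, b, c]]⟩ : CurveData)

/-- The polynomial `Σ_k π_k x^k ∈ ℂ[x, y]` with coefficient vector `π`. -/
local notation3 (prettyPrint := false) "Pol[" π "]" =>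
  (∑ k, C (π k) * (X 0 : MvPolynomial (Fin 2) ℂ) ^ (k : ℕ))

/-- The even polynomial `U = Σ_{k<3} μ_k x^{2k}` (Bézout cofactor of `f`). -/
local notation3 (prettyPrint := false) "Upol[" μ "]" =>
  (∑ k : Fin 3, C (μ k) * (X 0 : MvPolynomial (Fin 2) ℂ) ^ (2 * (k : ℕ)))

/-- The odd polynomial `V = Σ_{k<3} ν_k x^{2k+1}` (Bézout cofactor of `f′`). -/
local notation3 (prettyPrint := false) "Vpol[" ν "]" =>
  (∑ k : Fin 3, C (ν k) * (X 0 : MvPolynomial (Fin 2) ℂ) ^ (2 * (k : ℕ) + 1))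

/-- `θ[μ, ν, π] = (½ P U y) dx + (P V) dy`, the polynomial representative of `P(x) dx/(2y)`. -/
local notation3 (prettyPrint := false) "θ[" μ ", " ν ", " π "]" =>
  (![C (1 / 2 : ℂ) * Pol[π] * Upol[μ] * X 1, Pol[π] * Vpol[ν]] :
    Fin 2 → MvPolynomial (Fin 2) ℂ)

/-- The Bézout identity `U f + V f′ = 1` (scalar form). -/
local notation3 (prettyPrint := false) "Bez[" a ", " b ", " c ", " μ ", " ν "]" =>
  (∀ x : ℂ, (∑ k : Fin 3, μ k * x ^ (2 * (k : ℕ))) * (x ^ 6 + a * x ^ 4 + b * x ^ 2 + c) +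
    (∑ k : Fin 3, ν k * x ^ (2 * (k : ℕ) + 1)) * (6 * x ^ 5 + 4 * a * x ^ 3 + 2 * b * x) = 1)

/-- `P = x` (scalar form). -/
local notation3 (prettyPrint := false) "IsX[" π "]" => (∀ x : ℂ, ∑ k, π k * x ^ (k : ℕ) = x)

/-- `f(x) = F(x² + s)` with `F = X³ + AX + B`: the even sextic factors through `X = x² + s`. -/
local notation3 (prettyPrint := false) "Split[" a ", " b ", " c ", " s ", " A ", " B "]" =>
  ((a : ℂ) = 3 * s ∧ (b : ℂ) = 3 * s ^ 2 + A ∧ (c : ℂ) = s ^ 3 + A * s + B)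

variable {a b c : ℂ}

/-! ### The ovals of `E_{A,B}` -/

/-- **The oval of `E_{A,B}` over a 2-torsion interval as a `C¹` loop.**  Let
`X³ + AX + B = (X − p)(X − q)(X − r)` with real `p ≠ q`, `r`, and `−σ(X − r) > 0` for `X` between `p`
and `q` (`σ = ±1`), `η² = σ`, `ε = ±1`, `p ∈ ℚ̄`.  Then `X = (p+q)/2 + (p−q)/2 · cos 2πt`,
`Y = ε (p−q)/2 · sin 2πt · √(−σ(X − r))` are `C¹`, `(X − p)(X − q) = −((p−q)/2)² sin² 2πt` gives
`σY² = X³ + AX + B`, i.e. `(ηY)² = F(X)`, and `δ = (X, η·Y)` is a path on `E_{A,B}`, closed and based at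
the 2-torsion point `(p, 0)`, through `(q, 0)` at `t = ½`, `X` between `p` and `q`, on the sheets
`κY ≥ 0` (`t ≤ ½`), `κY ≤ 0` (`t ≥ ½`), `κ = ε(p−q)/2`. -/
theorem exists_weierOval {A B η : ℂ} {Ar Br p q r σ ε : ℝ} (hA : A = Ar) (hB : B = Br)
    (hfac : ∀ X : ℝ, X ^ 3 + Ar * X + Br = (X - p) * (X - q) * (X - r))
    (hσ : σ = 1 ∨ σ = -1) (hη : η ^ 2 = (σ : ℂ)) (hε : ε = 1 ∨ ε = -1)
    (hL : ∀ X ∈ uIcc p q, 0 < -σ * (X - r)) (hp : IsAlgebraic ℚ (p : ℂ)) :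
    ∃ (X Y : ℝ → ℝ) (δ : CurvePath (weierCurve A B)), ContDiff ℝ 1 X ∧ ContDiff ℝ 1 Y ∧
      (∀ t, δ.toFun t = ![(X t : ℂ), η * (Y t : ℂ)]) ∧
      (∀ t, X t = (p + q) / 2 + (p - q) / 2 * Real.cos (2 * Real.pi * t)) ∧
      (∀ t, Y t = ε * ((p - q) / 2) * Real.sin (2 * Real.pi * t) * √(-σ * (X t - r))) ∧
      (X 0 = p ∧ Y 0 = 0) ∧ (X 1 = p ∧ Y 1 = 0) ∧ (X (1 / 2) = q ∧ Y (1 / 2) = 0) ∧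
      (∀ t, X t ∈ uIcc p q) ∧ (∀ t, σ * Y t ^ 2 = X t ^ 3 + Ar * X t + Br) ∧
      ∀ t ∈ Icc (0 : ℝ) 1, (t ≤ 1 / 2 → 0 ≤ ε * ((p - q) / 2) * Y t) ∧
        (1 / 2 ≤ t → ε * ((p - q) / 2) * Y t ≤ 0) := by
  subst hA hB
  have hσ2 : σ ^ 2 = 1 := by rcases hσ with rfl | rfl <;> norm_num
  have hε2 : ε ^ 2 = 1 := by rcases hε with rfl | rfl <;> norm_num
  obtain ⟨X, hX⟩ : ∃ X : ℝ → ℝ,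
      X = fun t => (p + q) / 2 + (p - q) / 2 * Real.cos (2 * Real.pi * t) := ⟨_, rfl⟩
  have hXt : ∀ t, X t = (p + q) / 2 + (p - q) / 2 * Real.cos (2 * Real.pi * t) :=
    fun t => by rw [hX]
  have hXb : ∀ t, X t ∈ uIcc p q := fun t => by
    have hc1 := Real.neg_one_le_cos (2 * Real.pi * t)
    have hc2 := Real.cos_le_one (2 * Real.pi * t)
    rw [Set.mem_uIcc, hXt]
    rcases le_or_gt p q with hpq | hpq
    · left
      constructor <;> nlinarith [mul_nonneg (sub_nonneg.2 hpq) (sub_nonneg.2 hc2),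
        mul_nonneg (sub_nonneg.2 hpq) (neg_le_iff_add_nonneg'.1 hc1)]
    · right
      constructor <;> nlinarith [mul_nonneg (sub_nonneg.2 hpq.le) (sub_nonneg.2 hc2),
        mul_nonneg (sub_nonneg.2 hpq.le) (neg_le_iff_add_nonneg'.1 hc1)]
  have hLt : ∀ t, 0 < -σ * (X t - r) := fun t => hL _ (hXb t)
  obtain ⟨Y, hY⟩ : ∃ Y : ℝ → ℝ, Y = fun t =>
      ε * ((p - q) / 2) * Real.sin (2 * Real.pi * t) * √(-σ * (X t - r)) := ⟨_, rfl⟩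
  have hYt : ∀ t, Y t = ε * ((p - q) / 2) * Real.sin (2 * Real.pi * t) * √(-σ * (X t - r)) :=
    fun t => by rw [hY]
  have hXC : ContDiff ℝ 1 X := by
    rw [hX]
    exact contDiff_const.add (contDiff_const.mul
      (Real.contDiff_cos.comp (contDiff_const.mul contDiff_id)))
  have hQC : ContDiff ℝ 1 fun t => -σ * (X t - r) := contDiff_const.mul (hXC.sub contDiff_const)
  have hYC : ContDiff ℝ 1 Y := by
    rw [hY]
    exact (contDiff_const.mul (Real.contDiff_sin.comp (contDiff_const.mul contDiff_id))).mul
      (hQC.sqrt fun t => (hLt t).ne')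
  -- the curve equation
  have hcurve : ∀ t, σ * Y t ^ 2 = X t ^ 3 + Ar * X t + Br := fun t => by
    have hS := Real.sin_sq_add_cos_sq (2 * Real.pi * t)
    have hW : (√(-σ * (X t - r))) ^ 2 = -σ * (X t - r) := Real.sq_sqrt (hLt t).le
    have h1 : (X t - p) * (X t - q) = -((p - q) / 2) ^ 2 * Real.sin (2 * Real.pi * t) ^ 2 := by
      have hs2 : Real.sin (2 * Real.pi * t) ^ 2 = 1 - Real.cos (2 * Real.pi * t) ^ 2 := by
        linarith
      rw [hXt, hs2]
      ring
    have h2 : σ * Y t ^ 2 = -((p - q) / 2) ^ 2 * Real.sin (2 * Real.pi * t) ^ 2 * (X t - r) := by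
      rw [hYt]
      linear_combination (σ * ε ^ 2 * ((p - q) / 2) ^ 2 * Real.sin (2 * Real.pi * t) ^ 2) * hW -
        (ε ^ 2 * ((p - q) / 2) ^ 2 * Real.sin (2 * Real.pi * t) ^ 2 * (X t - r)) * hσ2 -
        (((p - q) / 2) ^ 2 * Real.sin (2 * Real.pi * t) ^ 2 * (X t - r)) * hε2
    rw [h2, hfac, h1]
  have hπ1 : 2 * Real.pi * (1 / 2 : ℝ) = Real.pi := by ring
  have hx0 : X 0 = p := by rw [hXt, mul_zero, Real.cos_zero]; ring
  have hx1 : X 1 = p := by rw [hXt, mul_one, Real.cos_two_pi]; ring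
  have hxh : X (1 / 2) = q := by rw [hXt, hπ1, Real.cos_pi]; ring
  have hy0 : Y 0 = 0 := by rw [hYt, mul_zero, Real.sin_zero]; ring
  have hy1 : Y 1 = 0 := by rw [hYt, mul_one, Real.sin_two_pi]; ring
  have hyh : Y (1 / 2) = 0 := by rw [hYt, hπ1, Real.sin_pi]; ring
  obtain ⟨φ, hφ⟩ : ∃ φ : ℝ → Fin 2 → ℂ, φ = fun t => ![(X t : ℂ), η * (Y t : ℂ)] := ⟨_, rfl⟩
  have e0 : (fun t : ℝ => ((X t : ℝ) : ℂ)) = ⇑Complex.ofRealCLM ∘ X := by funext t; simp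
  have e1 : (fun t : ℝ => η * ((Y t : ℝ) : ℂ)) = fun t => η * (⇑Complex.ofRealCLM ∘ Y) t := by
    funext t; simp
  refine ⟨X, Y, { toFun := φ
                  contDiffOn := ?_
                  mem_points := ?_
                  algebraic_zero := ?_
                  algebraic_one := ?_ }, hXC, hYC, fun t => by show φ t = _; rw [hφ], hXt, hYt,
    ⟨hx0, hy0⟩, ⟨hx1, hy1⟩, ⟨hxh, hyh⟩, hXb, hcurve,
    sin_sheet_pattern (fun t => Real.sqrt_nonneg _) hYt⟩
  · rw [contDiffOn_pi]
    intro j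
    rw [hφ]
    fin_cases j
    · simp only [Fin.zero_eta, Matrix.cons_val_zero]
      rw [e0]
      exact (Complex.ofRealCLM.contDiff.comp hXC).contDiffOn
    · simp only [Fin.mk_one, Matrix.cons_val_one, Matrix.cons_val_zero]
      rw [e1]
      exact (contDiff_const.mul (Complex.ofRealCLM.contDiff.comp hYC)).contDiffOn
  · intro t _
    rw [Weier.mem_points_iff, Weier.eval_fPoly, hφ]
    simp only [Matrix.cons_val_zero, Matrix.cons_val_one]
    rw [mul_pow, hη]
    exact_mod_cast hcurve t
  · intro i
    rw [hφ]
    fin_cases i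
    · simpa [hx0] using hp
    · simpa [hy0] using (isAlgebraic_zero : IsAlgebraic ℚ (0 : ℂ))
  · intro i
    rw [hφ]
    fin_cases i
    · simpa [hx1] using hp
    · simpa [hy1] using (isAlgebraic_zero : IsAlgebraic ℚ (0 : ℂ))

/-! ### Lifting through `φ_s` -/

/-- A real coordinate of a path is continuous on `[0, 1]`. -/
theorem continuousOn_realCoord {Z : CurveData} (γ : CurvePath Z) {i : Fin Z.n} {X : ℝ → ℝ}
    (hX : ∀ t, γ.toFun t i = (X t : ℂ)) : ContinuousOn X (Icc 0 1) := by
  have h := (continuousOn_pi.1 γ.contDiffOn.continuousOn) i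
  refine (Complex.continuous_re.comp_continuousOn h).congr fun t _ => ?_
  show X t = (γ.toFun t i).re
  rw [hX t, ofReal_re]

/-- A real coordinate of a path is `C¹` on `[0, 1]`. -/
theorem contDiffOn_realCoord {Z : CurveData} (γ : CurvePath Z) {i : Fin Z.n} {X : ℝ → ℝ}
    (hX : ∀ t, γ.toFun t i = (X t : ℂ)) : ContDiffOn ℝ 1 X (Icc 0 1) := by
  have h := (contDiffOn_pi.1 γ.contDiffOn) i
  refine (Complex.reCLM.contDiff.comp_contDiffOn h).congr fun t _ => ?_
  show X t = Complex.reCLM (γ.toFun t i)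
  rw [Complex.reCLM_apply, hX t, ofReal_re]

/-- **The lift through `φ_s`.**  If `f(x) = F(x² + s)` (`Split`, `s` real algebraic) and `δ = (X, Y)` is a
path on `E_{A,B}` with real first coordinate `X > s` on `[0, 1]`, then `γ = (√(X − s), Y)` is a path on
`C_{a,b,c}` (`f(√(X − s)) = F(X) = Y²`; end points algebraic with `X(0), X(1)`) and `φ_s ∘ γ = δ` on
`[0, 1]`. -/
theorem exists_liftPath {s A B : ℂ} {sr : ℝ} (hs : s = (sr : ℂ)) (hsa : IsAlgebraic ℚ s)
    (hsp : Split[a, b, c, s, A, B]) {X : ℝ → ℝ} {Yc : ℝ → ℂ} {δ : CurvePath (weierCurve A B)}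
    (hδ : ∀ t, δ.toFun t = ![(X t : ℂ), Yc t]) (hpos : ∀ t ∈ Icc (0 : ℝ) 1, sr < X t) :
    ∃ γ : CurvePath Cpl[a, b, c], (∀ t, γ.toFun t = ![((√(X t - sr) : ℝ) : ℂ), Yc t]) ∧
      ∀ t ∈ Icc (0 : ℝ) 1, δ.toFun t = ![γ.toFun t 0 ^ 2 + s, γ.toFun t 1] := by
  obtain ⟨ha, hb, hc⟩ := hsp
  have hδ0 : ∀ t, δ.toFun t 0 = (X t : ℂ) := fun t => by rw [hδ]; rfl
  have hδ1 : ∀ t, δ.toFun t 1 = Yc t := fun t => by rw [hδ]; rfl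
  have hXr : ContDiffOn ℝ 1 X (Icc 0 1) := contDiffOn_realCoord δ hδ0
  have hYc : ContDiffOn ℝ 1 Yc (Icc 0 1) := ((contDiffOn_pi.1 δ.contDiffOn) 1).congr fun t _ => (hδ1 t).symm
  have hxC : ContDiffOn ℝ 1 (fun t => √(X t - sr)) (Icc 0 1) :=
    (hXr.sub contDiffOn_const).sqrt fun t ht => (sub_pos.2 (hpos t ht)).ne'
  have hx2 : ∀ t ∈ Icc (0 : ℝ) 1, ((√(X t - sr) : ℝ) : ℂ) ^ 2 + s = X t := fun t ht => by
    rw [← ofReal_pow, Real.sq_sqrt (sub_pos.2 (hpos t ht)).le, hs]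
    push_cast
    ring
  have hmemE : ∀ t ∈ Icc (0 : ℝ) 1, Yc t ^ 2 = (X t : ℂ) ^ 3 + A * X t + B := fun t ht => by
    have h := δ.mem_points t ht
    rw [Weier.mem_points_iff, Weier.eval_fPoly, hδ] at h
    simpa using h
  have halg : ∀ {t}, (∀ i, IsAlgebraic ℚ (δ.toFun t i)) → 0 ≤ X t - sr →
      ∀ i, IsAlgebraic ℚ ((![((√(X t - sr) : ℝ) : ℂ), Yc t] : Fin 2 → ℂ) i) := by
    intro t hal hnn i
    fin_cases i
    · have h0 : IsAlgebraic ℚ (((X t - sr : ℝ)) : ℂ) := by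
        rw [ofReal_sub, ← hδ0 t, ← hs]
        exact (hal 0).sub hsa
      simpa using isAlgebraic_sqrt hnn h0
    · simpa [← hδ1 t] using hal 1
  have hI0 : (0 : ℝ) ∈ Icc (0 : ℝ) 1 := ⟨le_rfl, zero_le_one⟩
  have hI1 : (1 : ℝ) ∈ Icc (0 : ℝ) 1 := ⟨zero_le_one, le_rfl⟩
  refine ⟨{ toFun := fun t => ![((√(X t - sr) : ℝ) : ℂ), Yc t]
            contDiffOn := ?_
            mem_points := ?_
            algebraic_zero := halg δ.algebraic_zero (sub_pos.2 (hpos 0 hI0)).le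
            algebraic_one := halg δ.algebraic_one (sub_pos.2 (hpos 1 hI1)).le }, fun t => rfl,
    fun t ht => ?_⟩
  · rw [contDiffOn_pi]
    intro j
    fin_cases j
    · simp only [Fin.zero_eta, Matrix.cons_val_zero]
      exact (Complex.ofRealCLM.contDiff.comp_contDiffOn hxC).congr fun t _ => by simp
    · simpa using hYc
  · intro t ht
    rw [mem_points_iff]
    simp only [Matrix.cons_val_zero, Matrix.cons_val_one]
    rw [hmemE t ht, ha, hb, hc, ← hx2 t ht]
    ring
  · show δ.toFun t = ![((√(X t - sr) : ℝ) : ℂ) ^ 2 + s, Yc t]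
    rw [hx2 t ht, hδ]

/-! ### `∫_δ dX/Y = 4 · ∫_γ x dx/2y` for oval loops -/

/-- The chart `(u, y) ↦ (u, η·y)` of the plane is continuous. -/
theorem continuous_chart (η : ℂ) :
    Continuous fun p : ℝ × ℝ => (![(p.1 : ℂ), η * (p.2 : ℂ)] : Fin 2 → ℂ) := by
  refine continuous_pi fun i => ?_
  fin_cases i
  · simp only [Fin.zero_eta, Matrix.cons_val_zero]
    exact Complex.continuous_ofReal.comp' continuous_fst
  · simp only [Fin.mk_one, Matrix.cons_val_one, Matrix.cons_val_zero]
    exact continuous_const.mul (Complex.continuous_ofReal.comp' continuous_snd)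

/-- **kz1p's reduction vector as a theorem: `∫_δ dX/Y = 4 · ∫_γ x dx/2y`.**  Data: `C_{a,b,c}` with
`f(x) = F(x² + s)`, `F = X³ + AX + B` (`Split`; `a, b, c, s, A, B` algebraic, `s, A, B` real,
`4A³ + 27B² ≠ 0`); an interval `[lo, hi]` with `s < lo` and `σF ≥ 0` on it (`σ = ±1`, `η² = σ`); an oval
loop `δ = (X, η·Y)` of `E_{A,B}` (`X, Y` real, `X ∈ [lo, hi]` on `[0, 1]`, `F(X(½)) = 0`, sheets
`κ_E Y ≥ 0` before `t = ½` and `≤ 0` after); an oval loop `γ = (x, η·y)` of `C_{a,b,c}` (`x, y` real,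
`x ∈ [√(lo − s), √(hi − s)]`, sheets `κ_C y`, `κ_E κ_C > 0`) with `x = √(X − s)` at `t = 0, ½, 1`.  Then
`∫_δ θ₀ = 4 ∫_γ θ_x` (`θ₀ ∼ dX/Y`, `θ_x ∼ x dx/2y`): `relation_phi` (part 4) for the lift
`γ̃ = (√(X − s), η·Y)` of `δ` (`φ_s ∘ γ̃ = δ`), and `period_eq_of_ovalLoops` (part 6) for `γ̃`, `γ` in the
chart `(u, y) ↦ (u, η·y)` with `g(u) = σF(u² + s)`. -/
theorem relation_factorOval (ha : IsAlgebraic ℚ a) (hb : IsAlgebraic ℚ b) (hc : IsAlgebraic ℚ c)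
    {μ ν : Fin 3 → ℂ} (hμ : ∀ k, IsAlgebraic ℚ (μ k)) (hν : ∀ k, IsAlgebraic ℚ (ν k))
    (hbez : Bez[a, b, c, μ, ν]) {N : ℕ} {π : Fin N → ℂ} (hπa : ∀ k, IsAlgebraic ℚ (π k))
    (hπ : IsX[π]) {s A B : ℂ} (hsa : IsAlgebraic ℚ s) (hA : IsAlgebraic ℚ A) (hB : IsAlgebraic ℚ B)
    (hD : Weier.disc A B ≠ 0) (hsp : Split[a, b, c, s, A, B]) {sr Ar Br lo hi σ : ℝ} {η : ℂ}
    (hs : s = (sr : ℂ)) (hAr : A = (Ar : ℂ)) (hBr : B = (Br : ℂ)) (hlo : sr < lo)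
    (hσ : σ = 1 ∨ σ = -1) (hη : η ^ 2 = (σ : ℂ))
    (hF : ∀ u ∈ Icc lo hi, 0 ≤ σ * (u ^ 3 + Ar * u + Br)) {κE κC : ℝ} (hκ : 0 < κE * κC)
    {X Y : ℝ → ℝ} {δ : CurvePath (weierCurve A B)}
    (hδ : ∀ t, δ.toFun t = ![(X t : ℂ), η * (Y t : ℂ)])
    (hXb : ∀ t ∈ Icc (0 : ℝ) 1, X t ∈ Icc lo hi)
    (hYs : ∀ t ∈ Icc (0 : ℝ) 1, (t ≤ 1 / 2 → 0 ≤ κE * Y t) ∧ (1 / 2 ≤ t → κE * Y t ≤ 0))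
    (hXm : X (1 / 2) ^ 3 + Ar * X (1 / 2) + Br = 0)
    {x y : ℝ → ℝ} {γ : CurvePath Cpl[a, b, c]} (hγ : ∀ t, γ.toFun t = ![(x t : ℂ), η * (y t : ℂ)])
    (hxb : ∀ t ∈ Icc (0 : ℝ) 1, x t ∈ Icc (√(lo - sr)) (√(hi - sr)))
    (hys : ∀ t ∈ Icc (0 : ℝ) 1, (t ≤ 1 / 2 → 0 ≤ κC * y t) ∧ (1 / 2 ≤ t → κC * y t ≤ 0))
    (hx0 : x 0 = √(X 0 - sr)) (hx1 : x 1 = √(X 1 - sr)) (hxm : x (1 / 2) = √(X (1 / 2) - sr)) :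
    Pe[weierCurve A B, Weier.isSmoothAffineCurve A B hA hB hD, Weier.theta0 A B,
        Weier.hasAlgCoeffs_theta0 A B hA hB, δ] =
      4 * Pe[Cpl[a, b, c], smooth ha hb hc hbez, θ[μ, ν, π], hasAlgCoeffs_theta hμ hν hπa, γ] := by
  have hσ2r : σ ^ 2 = 1 := by rcases hσ with rfl | rfl <;> norm_num
  have hIh : (1 / 2 : ℝ) ∈ Icc (0 : ℝ) 1 := ⟨by norm_num, by norm_num⟩
  have hpos : ∀ t ∈ Icc (0 : ℝ) 1, sr < X t := fun t ht => hlo.trans_le (hXb t ht).1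
  -- the lift of `δ` and part 4
  obtain ⟨γ', hγ', himg⟩ := exists_liftPath hs hsa hsp hδ hpos
  have h1 := relation_phi ha hb hc hμ hν hbez hπa hπ hsa hA hB hD hsp (γ := γ') (γ' := δ) himg
  -- part 6 on `C_{a,b,c}` between the lift `γ'` and `γ`, in the chart `(u, v) ↦ (u, η·v)` with
  -- `g(u) = σF(u² + s)`
  obtain ⟨ha', hb', hc'⟩ := hsp
  have hδ0 : ∀ t, δ.toFun t 0 = (X t : ℂ) := fun t => by rw [hδ]; rfl
  have hγ0 : ∀ t, γ.toFun t 0 = (x t : ℂ) := fun t => by rw [hγ]; rfl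
  have hXc : ContinuousOn X (Icc 0 1) := continuousOn_realCoord δ hδ0
  have hxc : ContinuousOn x (Icc 0 1) := continuousOn_realCoord γ hγ0
  have hX0c : ContinuousOn (fun t => √(X t - sr)) (Icc 0 1) := (hXc.sub continuousOn_const).sqrt
  -- the real equations of the two loops
  have hqE : ∀ t ∈ Icc (0 : ℝ) 1, σ * Y t ^ 2 = X t ^ 3 + Ar * X t + Br := fun t ht => by
    have h := δ.mem_points t ht
    rw [Weier.mem_points_iff, Weier.eval_fPoly, hδ] at h
    simp only [Matrix.cons_val_one, Matrix.cons_val_zero, mul_pow, hη, hAr,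
      hBr] at h
    exact_mod_cast h
  have hqC : ∀ t ∈ Icc (0 : ℝ) 1,
      σ * y t ^ 2 = (x t ^ 2 + sr) ^ 3 + Ar * (x t ^ 2 + sr) + Br := fun t ht => by
    have h := γ.mem_points t ht
    rw [mem_points_iff, hγ] at h
    simp only [Matrix.cons_val_one, Matrix.cons_val_zero, mul_pow, hη, ha', hb',
      hc', hs, hAr, hBr] at h
    have h' : ((σ : ℝ) : ℂ) * (y t : ℂ) ^ 2 =
        ((x t : ℂ) ^ 2 + sr) ^ 3 + (Ar : ℂ) * ((x t : ℂ) ^ 2 + sr) + Br := by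
      rw [h]; ring
    exact_mod_cast h'
  have hg0 : ∀ u ∈ Icc (√(lo - sr)) (√(hi - sr)),
      0 ≤ σ * ((u ^ 2 + sr) ^ 3 + Ar * (u ^ 2 + sr) + Br) := fun u hu => by
    have hl : lo - sr ≤ u ^ 2 := by
      have := pow_le_pow_left₀ (Real.sqrt_nonneg _) hu.1 2
      rwa [Real.sq_sqrt (sub_pos.2 hlo).le] at this
    have hlohi : lo ≤ hi := by
      obtain ⟨h0, h0'⟩ := hXb 0 ⟨le_rfl, zero_le_one⟩
      exact h0.trans h0'
    have hh : u ^ 2 ≤ hi - sr := by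
      have := pow_le_pow_left₀ ((Real.sqrt_nonneg _).trans hu.1) hu.2 2
      rwa [Real.sq_sqrt (by linarith)] at this
    exact hF _ ⟨by linarith, by linarith⟩
  have hmem : ∀ u ∈ Icc (√(lo - sr)) (√(hi - sr)), ∀ v : ℝ,
      v ^ 2 = σ * ((u ^ 2 + sr) ^ 3 + Ar * (u ^ 2 + sr) + Br) →
        (![(u : ℂ), η * (v : ℂ)] : Fin 2 → ℂ) ∈ Cpl[a, b, c].points := fun u _ v hv => by
    rw [mem_points_iff]
    simp only [Matrix.cons_val_one, Matrix.cons_val_zero, mul_pow, hη, ha', hb',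
      hc', hs, hAr, hBr]
    have h2 : σ * v ^ 2 = (u ^ 2 + sr) ^ 3 + Ar * (u ^ 2 + sr) + Br := by
      rw [hv]; linear_combination ((u ^ 2 + sr) ^ 3 + Ar * (u ^ 2 + sr) + Br) * hσ2r
    have hv' : ((σ : ℝ) : ℂ) * (v : ℂ) ^ 2 =
        ((u : ℂ) ^ 2 + sr) ^ 3 + (Ar : ℂ) * ((u : ℂ) ^ 2 + sr) + Br := by exact_mod_cast h2
    rw [hv']
    ring
  have hb0 : ∀ t ∈ Icc (0 : ℝ) 1, √(X t - sr) ∈ Icc (√(lo - sr)) (√(hi - sr)) := fun t ht =>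
    ⟨Real.sqrt_le_sqrt (sub_le_sub_right (hXb t ht).1 _),
      Real.sqrt_le_sqrt (sub_le_sub_right (hXb t ht).2 _)⟩
  have hq0 : ∀ t ∈ Icc (0 : ℝ) 1, Y t ^ 2 =
      σ * ((√(X t - sr) ^ 2 + sr) ^ 3 + Ar * (√(X t - sr) ^ 2 + sr) + Br) := fun t ht => by
    rw [Real.sq_sqrt (sub_pos.2 (hpos t ht)).le, sub_add_cancel]
    linear_combination σ * hqE t ht - (Y t ^ 2) * hσ2r
  have hq1 : ∀ t ∈ Icc (0 : ℝ) 1, y t ^ 2 =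
      σ * ((x t ^ 2 + sr) ^ 3 + Ar * (x t ^ 2 + sr) + Br) := fun t ht => by
    linear_combination σ * hqC t ht - (y t ^ 2) * hσ2r
  have hgm : σ * ((√(X (1 / 2) - sr) ^ 2 + sr) ^ 3 + Ar * (√(X (1 / 2) - sr) ^ 2 + sr) + Br) = 0 := by
    rw [Real.sq_sqrt (sub_pos.2 (hpos _ hIh)).le, sub_add_cancel, hXm, mul_zero]
  have hgc : Continuous fun u : ℝ => σ * ((u ^ 2 + sr) ^ 3 + Ar * (u ^ 2 + sr) + Br) := by
    fun_prop
  have h2 : Pe[Cpl[a, b, c], smooth ha hb hc hbez, θ[μ, ν, π], hasAlgCoeffs_theta hμ hν hπa, γ'] =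
      Pe[Cpl[a, b, c], smooth ha hb hc hbez, θ[μ, ν, π], hasAlgCoeffs_theta hμ hν hπa, γ] :=
    period_eq_of_ovalLoops (smooth ha hb hc hbez) θ[μ, ν, π] (hasAlgCoeffs_theta hμ hν hπa)
      (fun u v => ![(u : ℂ), η * (v : ℂ)]) (continuous_chart η)
      (g := fun u => σ * ((u ^ 2 + sr) ^ 3 + Ar * (u ^ 2 + sr) + Br)) hgc hg0 hmem hκ hX0c hxc
      hb0 hxb hq0 hq1 hYs hys hx0 hx1 hxm hgm γ' γ (fun t _ => hγ' t) (fun t _ => hγ t)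
  rw [h1, h2]

end Summit.KontsevichZagierPeriods.KzOnePeriods.G2SDerivation

end
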